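import Summits.QuantumFields.YangMills.Theorems.FradkinShenkerFlowFiniteSusceptibilityWeakCouplingMirrorFunnel
import HarnessLib

/-!
# `FiniteSusceptibilityWeakCoupling` — the purity / rate split (crux-strategist decomposition of item 9442)

Crux `stmt-QuantumFields-9442` = `FradkinShenkerFlow.FiniteSusceptibilityWeakCoupling` (route `FradkinShenkerFlow`,
sub-problem `YangMills`): `∀ G simple ∀ r ∃ β₀ ∀ β ≥ β₀, FSClause β` — absolutely summable connected correlations of all
pairs of gauge-invariant local observables on the odd tori `(2S+1)⁴`, uniformly in `S`, at every weak coupling.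

Every registered line of this crux is a reflection-positivity FUNNEL whose single open stub is the crux's own
infrared content `C⁺` (time-axis cubic moments; `…SiblingFunnel`, `…MirrorFunnel`), and the refuters' kill-shape
analysis (Disproof.lean §"Why it resists", TRIAGE-r1-1 §B, TRIAGE-r1-2) shows that finite susceptibility can fail at
weak coupling in exactly two WAYS of different mathematical type:

* **(0) zero-rate failures** — connected correlations that do not tend to zero uniformly in the volume: phase
  coexistence / long-range order at couplings accumulating at `β = ∞` (bulk first-order lines of mixed-character
  actions, Bhanot–Creutz), spontaneous breaking of a lattice symmetry, or a torus-scale "thermal floor" (slice gap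
  `O(1/S)`); these are GROUP-BLIND enemies (they have nothing to do with the abelian counter-mechanism);
* **(1) rate failures** — correlations that do tend to zero, but too slowly to be summable in `d = 4` (a gauge-INVARIANT
  infrared field of dimension `≤ 2`: an emergent photon, a light scalar). This is precisely how `U(1)₄` violates the
  clause (Coulomb phase: `Cov ~ |x|⁻⁴`, `Σ|Cov| ~ log S`, Fröhlich–Spencer 1982 §2.11), so this half carries the
  whole load of the hypothesis `IsCompactSimpleLieGroup` (Disproof `withoutSimple_false_of_u1TorusPlaquetteNonSummable`).

This file types the two halves as statements over existing declarations and proves, sorry-free, that together they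
give the crux:

* `Sub₀` **weak-coupling decorrelation** (`WeakCouplingDecorrelation`, spelled out inline below): at every `β ≥ β₀(G,r)`
  the connected time-correlation `latticeConnectedCorr r.ρ β (2S+1) A B n` of every pair tends to `0` as `n → ∞`
  UNIFORMLY in the tori `S ≥ n` (zero-rate; includes the torus-scale lags `n ≍ S`);
* `Sub₁` **decorrelation forces summability** (`DecorrelationForcesSummability`): at every `β ≥ β₀(G,r)`, IF all pairs
  decorrelate uniformly THEN the susceptibility clause `FSClause β` holds (the rate window `0 < 2Δ ≤ 4` is empty);
* `finiteSusceptibilityWeakCoupling_of_subs : Sub₀ → Sub₁ → FiniteSusceptibilityWeakCoupling` (pointwise modus ponens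
  in `β`, `β₀ := max`).

Certificates that the cut is the natural one (all at fixed `(G, r, β)`, every compact `G`):
* `decorrelation_of_mirrorDecorrelation`: `Sub₀`'s clause follows from (and trivially contains)
  its reflection-positive diagonal form — no species has long-range order against its own mirror image
  (`A` vs `A ∘ Θ`, both lag conventions), each such term being `≥ 0` beyond the support scale
  (`MirrorPositivity.mirrorCorr_nonneg_eventually`); proof by the landed explicit-pair mirror domination
  `MirrorFunnel.abs_cov_axial_le_mirror`;
* `decorrelationAt_of_clusteringAt`: exponential time clustering at `β` (the shape of every sibling lattice-gap leg)
  implies `Sub₀`'s clause at `β` — `Sub₀` is weaker than every gap leg;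
* `decorrelationForcesSummability_of_finiteSusceptibility`: the crux implies `Sub₁` (trivially) — `Sub₁` is weaker
  than the crux. (`Sub₀` is implied by the crux too, through monotonicity of the torus mirror functions in the lag;
  not formalised here.)

No definition is introduced; nothing here is a named fact. References: Disproof.lean of this crux (cdisprove cycle 1);
J. Fröhlich, T. Spencer, Comm. Math. Phys. 83 (1982) 411, §2.11; A. Guth, Phys. Rev. D 21 (1980) 2291;
G. Bhanot, M. Creutz, Phys. Rev. D 24 (1981) 3212; S. Chatterjee, arXiv:1803.01950, Problem 5.1.
-/

set_option autoImplicit false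

noncomputable section

open MeasureTheory ProbabilityTheory Finset
open scoped BigOperators
open Literature.MathematicalPhysics.QuantumFieldTheory hiding Site ZdEdge
open Literature.MathematicalPhysics.QuantumLattice
open Literature.Probability.LatticeModels hiding configShift configShift_apply

namespace Summit.QuantumFields.YangMills.Theorems.FiniteSusceptibilityWeakCoupling

namespace Split

open MirrorDominationAxis0

variable {G : Type} [Group G] [TopologicalSpace G] [IsTopologicalGroup G] [CompactSpace G]
  [MeasurableSpace G] [BorelSpace G]

/-- **Mirror-diagonal decorrelation ⇒ all-pairs decorrelation** (every compact `G`, every `β ≥ 0`): by the landed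
explicit-pair mirror domination (`MirrorFunnel.abs_cov_axial_le_mirror`: for `n₀(A,B) ≤ n ≤ S`,
`|Cov_S(A, τ_n B)| ≤ Σ_{j ≤ S, |j-n| ≤ 1} (|Cov_S(A, τ_j Aᴿ)| + |Cov_S(Aᴿ, τ_j A)| + |Cov_S(Bᴿ, τ_j B)|)`), the window
having at most three lags, each beyond `j₀` once `n ≥ j₀ + 1`. So `Sub₀` is an order-parameter statement: no species
has long-range order against its own mirror image. [folklore] -/
theorem decorrelation_of_mirrorDecorrelation (r : LatticeRep G) {β : ℝ} (hβ : 0 ≤ β)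
    (h : ∀ A : YMSpecies G, ∀ ε : ℝ, 0 < ε → ∃ j₀ : ℕ, ∀ S j : ℕ, j₀ ≤ j → j ≤ S →
      |latticeConnectedCorr r.ρ β (2 * S + 1) A.F (fun V => A.F (cfgReflect V)) j| ≤ ε ∧
        |latticeConnectedCorr r.ρ β (2 * S + 1) (fun V => A.F (cfgReflect V)) A.F j| ≤ ε) :
    ∀ A B : YMSpecies G, ∀ ε : ℝ, 0 < ε → ∃ n₀ : ℕ, ∀ S n : ℕ, n₀ ≤ n → n ≤ S →
      |latticeConnectedCorr r.ρ β (2 * S + 1) A.F B.F n| ≤ ε := by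
  intro A B ε hε
  obtain ⟨n₁, hdom⟩ := MirrorFunnel.abs_cov_axial_le_mirror r hβ A B
  have hε9 : 0 < ε / 9 := by positivity
  obtain ⟨jA, hA⟩ := h A (ε / 9) hε9
  obtain ⟨jB, hB⟩ := h B (ε / 9) hε9
  refine ⟨max n₁ (max jA jB + 1), fun S n hn hnS => ?_⟩
  have hn₁ : n₁ ≤ n := le_trans (le_max_left _ _) hn
  have hnj : max jA jB + 1 ≤ n := le_trans (le_max_right _ _) hn
  -- rewrite every covariance as a `latticeConnectedCorr`
  have key := hdom S n hn₁ hnS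
  rw [SiblingFunnel.covariance_eq_latticeConnectedCorr r β A B S n] at key
  have e0 : ∀ j : ℕ, cov[fun U => A.F (torusLift (2 * S + 1) U),
      fun U => A.F (cfgReflect (configShift (-(Pi.single 0 (j : ℤ))) (torusLift (2 * S + 1) U)));
      wilsonMeasure (d := 4) (L := 2 * S + 1) r.ρ β] =
      latticeConnectedCorr r.ρ β (2 * S + 1) A.F (fun V => A.F (cfgReflect V)) j :=
    fun j => SiblingFunnel.covariance_eq_latticeConnectedCorr r β A (reflSpecies A) S j
  have e1 : ∀ j : ℕ, cov[fun U => A.F (cfgReflect (torusLift (2 * S + 1) U)),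
      fun U => A.F (configShift (-(Pi.single 0 (j : ℤ))) (torusLift (2 * S + 1) U));
      wilsonMeasure (d := 4) (L := 2 * S + 1) r.ρ β] =
      latticeConnectedCorr r.ρ β (2 * S + 1) (fun V => A.F (cfgReflect V)) A.F j :=
    fun j => SiblingFunnel.covariance_eq_latticeConnectedCorr r β (reflSpecies A) A S j
  have e2 : ∀ j : ℕ, cov[fun U => B.F (cfgReflect (torusLift (2 * S + 1) U)),
      fun U => B.F (configShift (-(Pi.single 0 (j : ℤ))) (torusLift (2 * S + 1) U));
      wilsonMeasure (d := 4) (L := 2 * S + 1) r.ρ β] =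
      latticeConnectedCorr r.ρ β (2 * S + 1) (fun V => B.F (cfgReflect V)) B.F j :=
    fun j => SiblingFunnel.covariance_eq_latticeConnectedCorr r β (reflSpecies B) B S j
  simp only [e0, e1, e2] at key
  -- each window term is at most `3 · ε/9`, and the window has at most three lags
  set W := (range (S + 1)).filter (fun j => n ≤ j + 1 ∧ j ≤ n + 1) with hW
  have hterm : ∀ j ∈ W,
      |latticeConnectedCorr r.ρ β (2 * S + 1) A.F (fun V => A.F (cfgReflect V)) j| +
        |latticeConnectedCorr r.ρ β (2 * S + 1) (fun V => A.F (cfgReflect V)) A.F j| +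
        |latticeConnectedCorr r.ρ β (2 * S + 1) (fun V => B.F (cfgReflect V)) B.F j| ≤ ε / 3 := by
    intro j hj
    rw [hW, mem_filter, mem_range] at hj
    have hjS : j ≤ S := by omega
    have hjA : jA ≤ j := by omega
    have hjB : jB ≤ j := by omega
    obtain ⟨a1, a2⟩ := hA S j hjA hjS
    obtain ⟨-, b2⟩ := hB S j hjB hjS
    linarith
  have hcard : W.card ≤ 3 := by
    calc W.card ≤ (Icc (n - 1) (n + 1)).card := by
          refine card_le_card fun j hj => ?_
          rw [hW, mem_filter, mem_range] at hj
          rw [mem_Icc]; omega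
      _ = 3 := by rw [Nat.card_Icc]; omega
  calc |latticeConnectedCorr r.ρ β (2 * S + 1) A.F B.F n|
      ≤ ∑ j ∈ W, (|latticeConnectedCorr r.ρ β (2 * S + 1) A.F (fun V => A.F (cfgReflect V)) j| +
          |latticeConnectedCorr r.ρ β (2 * S + 1) (fun V => A.F (cfgReflect V)) A.F j| +
          |latticeConnectedCorr r.ρ β (2 * S + 1) (fun V => B.F (cfgReflect V)) B.F j|) := key
    _ ≤ ∑ _j ∈ W, ε / 3 := sum_le_sum hterm
    _ = W.card * (ε / 3) := by rw [sum_const, nsmul_eq_mul]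
    _ ≤ 3 * (ε / 3) := by
          have h3 : (W.card : ℝ) ≤ 3 := by exact_mod_cast hcard
          exact mul_le_mul_of_nonneg_right h3 (by positivity)
    _ = ε := by ring

/-- **Every exponential time-clustering leg gives `Sub₀`'s clause** (fixed `(G, r, β)`, every compact `G`): clustering
with rate `m > 0`, a constant per pair and a pair-dependent volume threshold (the common shape of the sub-problem's
lattice-gap legs 8778 / 8761 / 8901 / 8715) implies uniform decorrelation — `C e^{-mn} ≤ ε` for `n` large, and the
threshold `S₀ ≤ S` is met because `n ≤ S`. So `Sub₀` is weaker than every gap leg. [folklore] -/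
theorem decorrelationAt_of_clusteringAt (r : LatticeRep G) (β : ℝ) {m : ℝ} (hm : 0 < m)
    (hAB : ∀ A B : YMSpecies G, ∃ (C : ℝ) (S₀ : ℕ), ∀ S : ℕ, S₀ ≤ S → ∀ n : ℕ, n ≤ S →
        |latticeConnectedCorr r.ρ β (2 * S + 1) A.F B.F n| ≤ C * Real.exp (-(m * n))) :
    ∀ A B : YMSpecies G, ∀ ε : ℝ, 0 < ε → ∃ n₀ : ℕ, ∀ S n : ℕ, n₀ ≤ n → n ≤ S →
      |latticeConnectedCorr r.ρ β (2 * S + 1) A.F B.F n| ≤ ε := by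
  intro A B ε hε
  obtain ⟨C, S₀, hC⟩ := hAB A B
  -- choose `n₀ ≥ S₀` with `C e^{-m n₀} ≤ ε`
  obtain ⟨N, hN⟩ : ∃ N : ℕ, ∀ n : ℕ, N ≤ n → C * Real.exp (-(m * n)) ≤ ε := by
    have ht : Filter.Tendsto (fun n : ℕ => C * Real.exp (-(m * n))) Filter.atTop (nhds (C * 0)) := by
      refine Filter.Tendsto.const_mul C ?_
      have h1 : Filter.Tendsto (fun n : ℕ => m * (n : ℝ)) Filter.atTop Filter.atTop :=
        Filter.Tendsto.const_mul_atTop hm tendsto_natCast_atTop_atTop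
      exact Real.tendsto_exp_neg_atTop_nhds_zero.comp h1
    rw [mul_zero] at ht
    obtain ⟨N, hN⟩ := (Filter.tendsto_atTop'.1 ht) (Set.Iic ε) (Iic_mem_nhds hε)
    exact ⟨N + 1, fun n hn => hN n (by omega)⟩
  refine ⟨max N S₀, fun S n hn hnS => ?_⟩
  have hS : S₀ ≤ S := le_trans (le_trans (le_max_right _ _) hn) hnS
  exact (hC S hS n hnS).trans (hN n (le_trans (le_max_left _ _) hn))

end Split

/-- **The crux implies `Sub₁`** (trivially: a conclusion that holds outright holds under any hypothesis) — `Sub₁` is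
weaker than the crux; it is FALSE with `IsCompactSimpleLieGroup` deleted (the `U(1)₄` Coulomb phase decorrelates but is
not summable), so it is the half of the crux that must use simplicity. [folklore] -/
theorem decorrelationForcesSummability_of_finiteSusceptibility
    (h : Summit.QuantumFields.YangMills.Theses.FradkinShenkerFlow.FiniteSusceptibilityWeakCoupling) :
    ∀ (G : Type) [Group G] [TopologicalSpace G] [IsTopologicalGroup G] [CompactSpace G] [MeasurableSpace G]
      [BorelSpace G], IsCompactSimpleLieGroup G → ∀ r : LatticeRep G, ∃ β₀ : ℝ, ∀ β : ℝ, β₀ ≤ β →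
      (∀ A B : YMSpecies G, ∀ ε : ℝ, 0 < ε → ∃ n₀ : ℕ, ∀ S n : ℕ, n₀ ≤ n → n ≤ S →
        |latticeConnectedCorr r.ρ β (2 * S + 1) A.F B.F n| ≤ ε) →
      ∀ A B : YMSpecies G, ∃ χ : ℝ, ∀ S : ℕ,
        ∑ x ∈ box 4 S, |cov[fun U => A.F (torusLift (2 * S + 1) U),
          fun U => B.F (configShift (-x) (torusLift (2 * S + 1) U));
          wilsonMeasure (d := 4) (L := 2 * S + 1) r.ρ β]| ≤ χ := by
  intro G _ _ _ _ _ _ hG r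
  obtain ⟨β₀, hβ₀⟩ := h G hG r
  exact ⟨β₀, fun β hβ _ => hβ₀ β hβ⟩

/-- **THE SPLIT: `Sub₀ → Sub₁ → FiniteSusceptibilityWeakCoupling`** (crux-strategist decomposition of item
stmt-QuantumFields-9442; hypotheses spelled out verbatim as the two sub-crux statements `WeakCouplingDecorrelation`
and `DecorrelationForcesSummability`, conclusion the crux BY NAME). Pure logic: for `G, r` take `β₀ := max β₀⁰ β₀¹`;
at `β ≥ β₀` the decorrelation clause of `Sub₀` is the hypothesis of `Sub₁`, whose conclusion is the crux's clause. [folklore] -/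
theorem finiteSusceptibilityWeakCoupling_of_subs
    (h₀ : ∀ (G : Type) [Group G] [TopologicalSpace G] [IsTopologicalGroup G] [CompactSpace G] [MeasurableSpace G]
      [BorelSpace G], Literature.MathematicalPhysics.QuantumFieldTheory.IsCompactSimpleLieGroup G →
      ∀ r : Literature.MathematicalPhysics.QuantumFieldTheory.LatticeRep G, ∃ β₀ : ℝ, ∀ β : ℝ, β₀ ≤ β →
      ∀ A B : Literature.MathematicalPhysics.QuantumFieldTheory.YMSpecies G, ∀ ε : ℝ, 0 < ε → ∃ n₀ : ℕ,
      ∀ S n : ℕ, n₀ ≤ n → n ≤ S →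
        |Literature.MathematicalPhysics.QuantumFieldTheory.latticeConnectedCorr r.ρ β (2 * S + 1) A.F B.F n| ≤ ε)
    (h₁ : ∀ (G : Type) [Group G] [TopologicalSpace G] [IsTopologicalGroup G] [CompactSpace G] [MeasurableSpace G]
      [BorelSpace G], Literature.MathematicalPhysics.QuantumFieldTheory.IsCompactSimpleLieGroup G →
      ∀ r : Literature.MathematicalPhysics.QuantumFieldTheory.LatticeRep G, ∃ β₀ : ℝ, ∀ β : ℝ, β₀ ≤ β →
      (∀ A B : Literature.MathematicalPhysics.QuantumFieldTheory.YMSpecies G, ∀ ε : ℝ, 0 < ε → ∃ n₀ : ℕ,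
        ∀ S n : ℕ, n₀ ≤ n → n ≤ S →
          |Literature.MathematicalPhysics.QuantumFieldTheory.latticeConnectedCorr r.ρ β (2 * S + 1) A.F B.F n| ≤ ε) →
      ∀ A B : Literature.MathematicalPhysics.QuantumFieldTheory.YMSpecies G, ∃ χ : ℝ, ∀ S : ℕ,
        ∑ x ∈ Literature.Probability.LatticeModels.box 4 S,
          |ProbabilityTheory.covariance
            (fun U => A.F (Literature.MathematicalPhysics.QuantumLattice.torusLift (2 * S + 1) U))
            (fun U => B.F (Literature.MathematicalPhysics.QuantumLattice.configShift (-x)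
              (Literature.MathematicalPhysics.QuantumLattice.torusLift (2 * S + 1) U)))
            (Literature.MathematicalPhysics.QuantumFieldTheory.wilsonMeasure (d := 4) (L := 2 * S + 1) r.ρ β)| ≤ χ) :
    Summit.QuantumFields.YangMills.Theses.FradkinShenkerFlow.FiniteSusceptibilityWeakCoupling := by
  intro G _ _ _ _ _ _ hG r
  obtain ⟨β₀, hβ₀⟩ := h₀ G hG r
  obtain ⟨β₁, hβ₁⟩ := h₁ G hG r
  refine ⟨max β₀ β₁, fun β hβ => ?_⟩
  exact hβ₁ β (le_trans (le_max_right _ _) hβ) (hβ₀ β (le_trans (le_max_left _ _) hβ))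

/-- **`Sub₀` in mirror-diagonal form suffices** (global corollary of `decorrelation_of_mirrorDecorrelation`, `β₀ ↦ max β₀ 0`):
if at every `β ≥ β₀(G,r)` no species has long-range order against its own mirror image, and `Sub₁` holds, then the crux
holds. [folklore] -/
theorem finiteSusceptibilityWeakCoupling_of_mirrorDecorrelation_of_upgrade
    (h₀ : ∀ (G : Type) [Group G] [TopologicalSpace G] [IsTopologicalGroup G] [CompactSpace G] [MeasurableSpace G]
      [BorelSpace G], IsCompactSimpleLieGroup G → ∀ r : LatticeRep G, ∃ β₀ : ℝ, ∀ β : ℝ, β₀ ≤ β →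
      ∀ A : YMSpecies G, ∀ ε : ℝ, 0 < ε → ∃ j₀ : ℕ, ∀ S j : ℕ, j₀ ≤ j → j ≤ S →
        |latticeConnectedCorr r.ρ β (2 * S + 1) A.F (fun V => A.F (cfgReflect V)) j| ≤ ε ∧
          |latticeConnectedCorr r.ρ β (2 * S + 1) (fun V => A.F (cfgReflect V)) A.F j| ≤ ε)
    (h₁ : ∀ (G : Type) [Group G] [TopologicalSpace G] [IsTopologicalGroup G] [CompactSpace G] [MeasurableSpace G]
      [BorelSpace G], IsCompactSimpleLieGroup G → ∀ r : LatticeRep G, ∃ β₀ : ℝ, ∀ β : ℝ, β₀ ≤ β →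
      (∀ A B : YMSpecies G, ∀ ε : ℝ, 0 < ε → ∃ n₀ : ℕ, ∀ S n : ℕ, n₀ ≤ n → n ≤ S →
        |latticeConnectedCorr r.ρ β (2 * S + 1) A.F B.F n| ≤ ε) →
      ∀ A B : YMSpecies G, ∃ χ : ℝ, ∀ S : ℕ,
        ∑ x ∈ box 4 S, |cov[fun U => A.F (torusLift (2 * S + 1) U),
          fun U => B.F (configShift (-x) (torusLift (2 * S + 1) U));
          wilsonMeasure (d := 4) (L := 2 * S + 1) r.ρ β]| ≤ χ) :
    Summit.QuantumFields.YangMills.Theses.FradkinShenkerFlow.FiniteSusceptibilityWeakCoupling := by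
  refine finiteSusceptibilityWeakCoupling_of_subs (fun G _ _ _ _ _ _ hG r => ?_) h₁
  obtain ⟨β₀, hβ₀⟩ := h₀ G hG r
  refine ⟨max β₀ 0, fun β hβ => ?_⟩
  exact Split.decorrelation_of_mirrorDecorrelation r (le_trans (le_max_right _ _) hβ)
    (hβ₀ β (le_trans (le_max_left _ _) hβ))

/-- **Registered sub-goal `stub_cruxOfSubs`** of item stmt-QuantumFields-9442 (signature verbatim, fully qualified): the
purity / rate decomposition of line `purity-rate-split` — `Sub₀` (weak-coupling decorrelation of all pairs, zero rate,
torus-uniform) and `Sub₁` (at weak coupling, decorrelation forces the susceptibility clause) together imply the crux BY NAME.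
[folklore] -/
theorem stub_cruxOfSubs : (∀ (G : Type) [Group G] [TopologicalSpace G] [IsTopologicalGroup G] [CompactSpace G] [MeasurableSpace G] [BorelSpace G], Literature.MathematicalPhysics.QuantumFieldTheory.IsCompactSimpleLieGroup G → ∀ r : Literature.MathematicalPhysics.QuantumFieldTheory.LatticeRep G, ∃ β₀ : ℝ, ∀ β : ℝ, β₀ ≤ β → ∀ A B : Literature.MathematicalPhysics.QuantumFieldTheory.YMSpecies G, ∀ ε : ℝ, 0 < ε → ∃ n₀ : ℕ, ∀ S n : ℕ, n₀ ≤ n → n ≤ S → |Literature.MathematicalPhysics.QuantumFieldTheory.latticeConnectedCorr r.ρ β (2 * S + 1) A.F B.F n| ≤ ε) → (∀ (G : Type) [Group G] [TopologicalSpace G] [IsTopologicalGroup G] [CompactSpace G] [MeasurableSpace G] [BorelSpace G], Literature.MathematicalPhysics.QuantumFieldTheory.IsCompactSimpleLieGroup G → ∀ r : Literature.MathematicalPhysics.QuantumFieldTheory.LatticeRep G, ∃ β₀ : ℝ, ∀ β : ℝ, β₀ ≤ β → (∀ A B : Literature.MathematicalPhysics.QuantumFieldTheory.YMSpecies G, ∀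 ε : ℝ, 0 < ε → ∃ n₀ : ℕ, ∀ S n : ℕ, n₀ ≤ n → n ≤ S → |Literature.MathematicalPhysics.QuantumFieldTheory.latticeConnectedCorr r.ρ β (2 * S + 1) A.F B.F n| ≤ ε) → ∀ A B : Literature.MathematicalPhysics.QuantumFieldTheory.YMSpecies G, ∃ χ : ℝ, ∀ S : ℕ, ∑ x ∈ Literature.Probability.LatticeModels.box 4 S, |ProbabilityTheory.covariance (fun U => A.F (Literature.MathematicalPhysics.QuantumLattice.torusLift (2 * S + 1) U)) (fun U => B.F (Literature.MathematicalPhysics.QuantumLattice.configShift (-x) (Literature.MathematicalPhysics.QuantumLattice.torusLift (2 * S + 1) U))) (Literature.MathematicalPhysics.QuantumFieldTheory.wilsonMeasure (d := 4) (L := 2 * S + 1) r.ρ β)| ≤ χ) → Summit.QuantumFields.YangMills.Theses.FradkinShenkerFlow.FiniteSusceptibilityWeakCoupling :=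
  finiteSusceptibilityWeakCoupling_of_subs

end Summit.QuantumFields.YangMills.Theorems.FiniteSusceptibilityWeakCoupling

end
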